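/-
Copyright (c) 2026 the pub-hodgecm-mathlib formalisation cell (harness21).  Prover seat hodgecm-mathlib-F0P2-p10 (g4), Track B ∕ R90-TF, h413 = `stmt-HodgeConjecture-24833`,
R90-TF section S8 «ContSpec-n½», ESTATE T, J-S8-CO STEP (4) (S8 dealer R90-CS-plan (g3) S8-R232 (1); K2E1-p12 (g6) census R90 bus l.9746; chair K2-lead (g2) VALVE 21 (w)):
HILBERT PACKAGING of a finite-dimensional `K_∞`-stable block `W₀` of CONTINUOUS pair-sections — the `(X, π, hπ, hU, hirr)` hypotheses of ★ (α)
`R90S8KTypeSliceLineU3.exists_forall_homSpace_torus_eq_smul_of_transpose_realisation` at the EUCLIDEAN MODEL `X := EuclideanSpace ℂ (Fin n)` (`n = finrank ℂ ↥W₀`) of `W₀`, `Kv := ι(K_∞)`.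
-/
import Summits.HodgeConjecture.HodgeConjecture.Theorems.R90S8ResGMidAtomTauPureSplitU3   -- ★ p864443 (K2E1-p12): `archMaximalCompact_le_kMax`; brings ★ β2 p864185 `exists_invariant_definite_form_kMax` (the `∫_{K_max}` recipe re-run here as a CORE),
                                                                                          --   ★ `archMaximalCompact` (`R90S8ResGMidAtomTauU3Defs`), ★ pair defs `IsChiSectionPair`, ★ CM Iwasawa `exists_mem_borelAdelic_mul_mem_standardMaximalCompactGL_cm_three`, ★ `K_max` compact
import Literature.NumberTheory.Automorphic.CompactGroupCharacterProjectionIsotypic           -- ★ `isTopIrreducible_of_isIrreducible` (f.d.: algebraic ⇒ topological irreducibility); brings ★ `ContRepresentation.isUnitary_iff_inner_map_map`, `IsStronglyContinuous`, `IsUnitary`, `IsTopIrreducible`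
import Literature.RepresentationTheory.IrreducibleTwistTransport                         -- ★ `Representation.isIrreducible_iff_of_equivariant` (irreducibility along an equivariant linear equivalence)
import Mathlib.Analysis.InnerProductSpace.PiL2                                             -- Mathlib `EuclideanSpace`, `stdOrthonormalBasis`, `OrthonormalBasis.repr`; brings `InnerProductSpace.Core`, `InnerProductSpace.Core.toNormedAddCommGroup`, `InnerProductSpace.ofCore`
import Mathlib.Topology.Algebra.Module.FiniteDimension                                     -- Mathlib `LinearMap.toContinuousLinearMap`, `LinearEquiv.toContinuousLinearEquiv`
import HarnessLib

/-!
# S8 ESTATE T, J-S8-CO STEP (4) — `R90S8KFiniteBlockHilbertPackagingU3`: HILBERT PACKAGING OF A FINITE-DIMENSIONAL `K_∞`-STABLE BLOCK OF CONTINUOUS PAIR-SECTIONS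

Track B ∕ R90-TF, crux h413 = `stmt-HodgeConjecture-24833`, route of record `HCCMUnconditional`; cell `hodgecm-mathlib`, R90-TF section S8 «ContSpec-n½», ESTATE T (the `K`-finite Eisenstein
exports).  THEOREMS ONLY (no `def`, no `instance`, no `notation`, no named-fact hypothesis, no `sorry`; default heartbeats); lane `--supports stmt-HodgeConjecture-24833 --as helper`
(count-neutral).  CLOSES NO SOCKET.

WHERE THIS SITS (K2E1-p12 (g6)'s J-S8-CO census, R90 bus l.9746).  The co-weight LINE letter `hCO` of the τ-row exports is read off ★ (α) `exists_forall_homSpace_torus_eq_smul_of_transpose_realisation`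
(K2E1-p14), stated for a representation `π : ContRepresentation ℂ Kv X` on a HILBERT space `X` (`[NormedAddCommGroup X] [InnerProductSpace ℂ X] [CompleteSpace X]`) that is strongly continuous
(`hπ`), unitary (`hU`) and topologically irreducible (`hirr`).  The blocks at hand are finite-dimensional `ι(K_∞)`-stable spaces `W₀ ≤ (G(𝔸) → ℂ)` of CONTINUOUS `(χ₁, χ₂)`-pair-sections
(★ `exists_isotypic_of_kMax_irreducible`'s `W₀` inside a §5d pure block), acted on by `ρ₀ := r|_{W₀} = Subrepresentation.toRepresentation ⟨W₀, hW₀K⟩` (★ `AdelicGroupData.rightTranslation`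
composed with `(archMaximalCompact L).subtype` — the binder of p12's `hCO`).  This file supplies `(X, π, hπ, hU, hirr)` for such a `W₀` — step (4); steps (2) Riesz bridge, (3) the product
realisation of `K_∞`, (5) assembly are K2E1-p12 ∕ K2E1-p16's files.

DESIGN NOTE (why a Euclidean MODEL and not `X := ↥W₀`).  The ambient `G(𝔸) → ℂ` carries Mathlib's product topology and uniformity, so the subtype `↥W₀` already owns global
`TopologicalSpace`∕`UniformSpace` instances; a locally registered norm structure on `↥W₀` then loses every bare `[TopologicalSpace ↥W₀]`∕`[UniformSpace ↥W₀]` search (e.g. the binder of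
`ContRepresentation`, or `CompleteSpace`) to those global instances — a genuine diamond, observed on the farm.  So the Hilbert structure is delivered on the MODEL `EuclideanSpace ℂ (Fin n)`, `n = finrank ℂ ↥W₀`,
(canonical global Hilbert instances) together with a linear equivalence `e : ↥W₀ ≃ₗ[ℂ] EuclideanSpace ℂ (Fin _)` intertwining `ρ₀` with `π` (`π k (e w) = e (ρ₀ k w)`); co-weight functionals and
`Hom`-lines transport through `e` by composition (pure linear algebra; ★ `R90S8CoweightLineOfHomSpaceLineU3.coweightLine_of_linearEquiv`).  Internally the `K_max`-invariant inner product IS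
built on `↥W₀` (as an `InnerProductSpace.Core`, (2a)), and `e` is the coordinate map of an orthonormal basis for it (Mathlib `stdOrthonormalBasis`), an isometry for that core.  This is the
design K2E1-p12 (g6)'s J-S8-CO INTERFACE CARD (R90 bus 02:45:14Z) fixes for steps (3)(4)(5); (1c) and (2c) below are its items (4·i) and (4·ii) byte for byte.

THE MATHEMATICS ([BrockerTomDieck1985] II (1.7) Weyl's unitarian trick; [DeitmarEchterhoff2014] Lemma 6.1.7, §7.3; [Folland1995] §3.1; [BorelJacquet1979] §4.1).
* §1 GENERIC, finite dimension (pure Mathlib + three Literature ★ adapters).  (1a) `continuous_of_injective_of_continuous_apply`: a map `f : K → X` into a finite-dimensional Hausdorff topological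
  vector space is continuous as soon as its coordinates `k ↦ e (f k) i` against an injective linear `e : X →ₗ (ι → 𝕜)` are («coordinates against point evaluations»: `LinearEquiv.ofInjective` +
  `LinearEquiv.toContinuousLinearEquiv` on the finite-dimensional range).  (1b) `exists_contRepresentation_of_inner_map_map`: an algebraic representation `ρ` on a finite-dimensional Hilbert space
  with continuous orbit maps and `⟪ρ k x, ρ k y⟫ = ⟪x, y⟫` IS a strongly continuous unitary `ContRepresentation` `π` (`π k := LinearMap.toContinuousLinearMap (ρ k)`, `π.toRepresentation = ρ`;
  ★ `isUnitary_iff_inner_map_map`), topologically irreducible when `ρ` is (★ `isTopIrreducible_of_isIrreducible`).  (1c) `exists_contRepresentation_of_unitaryTrivialisation` (K2E1-p12's card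
  (4·i), bytes verbatim): the same through a UNITARY TRIVIALISATION `e : V ≃ₗ[ℂ] E` of an irreducible `ρ` on an arbitrary `ℂ`-space `V` — `π` on `E` with `π k (e v) = e (ρ k v)`, unitary,
  strongly continuous, topologically irreducible (irreducibility along `e` by ★ `Representation.isIrreducible_iff_of_equivariant`).
* §2 THE CM `U(3)` BLOCK.  (2a) `exists_core_kMax_invariant`: on ANY space `S` of continuous `(χ₁, χ₂)`-pair-sections the recipe of ★ β2 `exists_invariant_definite_form_kMax` —
  `⟪a, b⟫ := ∫_{K_max} conj (a x⁻¹) · b x⁻¹ ∂haar` — is an `InnerProductSpace.Core` (Hermitian by `integral_conj`, `re ⟪a, a⟫ = ∫ ‖a‖² ≥ 0`, sesquilinear, DEFINITE because a continuous section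
  vanishing on `K_max` vanishes: Haar is positive on opens, pair law + ★ CM adelic Iwasawa `G(𝔸) = B(𝔸)·K_max`), INVARIANT under `r(k)` for every `k ∈ K_max` (left-invariance of Haar on the
  compact group `K_max`; stated with membership binders, so it serves `ι(K_∞)`-stable and `K_max`-stable blocks alike; no finite-dimensionality needed).  (2b) `continuous_kInf_orbit_comp`: for a
  finite-dimensional `ι(K_∞)`-stable `W₀` of continuous functions and ANY linear equivalence `T : ↥W₀ ≃ₗ X` onto a finite-dimensional Hausdorff topological vector space, `k ↦ T (ρ₀ k w)` is
  continuous on `ι(K_∞)` ((1a) with `e := W₀.subtype ∘ T⁻¹`: the coordinates are the point evaluations `k ↦ w (x k)`).  (2c) `exists_unitaryTrivialisation_archMaximalCompact` (K2E1-p12's card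
  (4·ii), `e`-form): `∃ e : ↥W₀ ≃ₗ[ℂ] EuclideanSpace ℂ (Fin (finrank ℂ ↥W₀))` (the orthonormal coordinates of (2a)) with `⟪e (ρ₀ k v), e (ρ₀ k w)⟫ = ⟪e v, e w⟫` and `k ↦ e (ρ₀ k v)` continuous.
  (2d) HEAD `exists_hilbertPackaging_kInf_block` = (2c) + (1c): for `ρ₀` irreducible, `∃ e π` on `EuclideanSpace ℂ (Fin (finrank ℂ ↥W₀))` with `π k (e w) = e (ρ₀ k w)`, `π.IsUnitary`,
  `π.IsStronglyContinuous`, `π.IsTopIrreducible`: EXACTLY (α)'s hypotheses at `X := EuclideanSpace ℂ (Fin (finrank ℂ ↥W₀))`, `Kv := ↥(archMaximalCompact L)` (subtype topology of `G(𝔸)`).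
HONEST LABEL: HC_CM is proved only modulo the 7 printed citations (2 remaining named inputs: hLiu418 = `stmt-HodgeConjecture-24832`, h413 = `stmt-HodgeConjecture-24833`) until
rung 0 closes; REL ≠ ★ ≠ BUILT; this file asserts no named fact, pays no socket by itself ((α)-at-`K_∞` needs steps (2)(3)(5) too); count-neutral; unconditional.

## References
* [BrockerTomDieck1985] T. Bröcker, T. tom Dieck, *Representations of Compact Lie Groups*, GTM 98 (1985), II (1.7) (invariant inner products by Haar averaging).
* [DeitmarEchterhoff2014] A. Deitmar, S. Echterhoff, *Principles of Harmonic Analysis* (2nd ed., 2014), Lemma 6.1.7 (finite dimension: algebraic = topological irreducibility), §7.3.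
* [Folland1995] G. B. Folland, *A Course in Abstract Harmonic Analysis* (1995), §3.1 (unitary representations, strong continuity).
* [BorelJacquet1979] A. Borel, H. Jacquet, *Automorphic forms and automorphic representations*, Proc. Symp. Pure Math. 33.1 (1979), §4.1 (`K`-finite functions, `r(k)`).
* [MoeglinWaldspurger1995] C. Mœglin, J.-L. Waldspurger, *Spectral Decomposition and Eisenstein Series* (1995), I.2.17 (sections induced from `B(𝔸)`).
-/

set_option autoImplicit false
set_option linter.dupNamespace false  -- the mandated namespace `…HodgeConjecture.HodgeConjecture.R90.S8` (LEAD #1 L1) repeats the summit's segment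

noncomputable section

open MeasureTheory Measure Set Filter Topology NumberField ContRepresentation
open Literature.NumberTheory Literature.NumberTheory.Automorphic Literature.NumberTheory.Automorphic.UnitaryGroup Literature.NumberTheory.GaloisRepresentations AdelicGroupData
open Literature.NumberTheory.Automorphic.Arthur2013.Leaves.TECR Literature.NumberTheory.Rogawski1990
open Summit.HodgeConjecture.HodgeConjecture.Cruxes.H413.K2E1BorelEisensteinU
open Summit.HodgeConjecture.HodgeConjecture.Cruxes.H413.K2E1CharacterEisensteinU3PairDefs
open Summit.HodgeConjecture.HodgeConjecture.Cruxes.H413.K2E1ChiSectionSpaceU3PairDefs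
open scoped ENNReal NNReal ComplexConjugate InnerProductSpace

namespace Summit.HodgeConjecture.HodgeConjecture.R90.S8

/-! ## §1 Generic finite-dimensional packaging -/

section Generic

/-- **(1a) CONTINUITY INTO A FINITE-DIMENSIONAL SPACE FROM COORDINATES** («coordinates against point evaluations»): for a finite-dimensional Hausdorff topological vector space `X` over a
complete field, an injective linear `e : X →ₗ (ι → 𝕜)` and a map `f : K → X` all of whose coordinates `k ↦ e (f k) i` are continuous, `f` is continuous — `e` is a linear homeomorphism onto
its (finite-dimensional, Hausdorff) range (`LinearEquiv.ofInjective`, `LinearEquiv.toContinuousLinearEquiv`), and a map into the range is continuous iff its coordinates are.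
[cite: DeitmarEchterhoff2014, Lemma 6.1.7] [cite: Folland1995, §3.1] -/
theorem continuous_of_injective_of_continuous_apply {𝕜 : Type*} [NontriviallyNormedField 𝕜] [CompleteSpace 𝕜]
    {X : Type*} [AddCommGroup X] [Module 𝕜 X] [TopologicalSpace X] [IsTopologicalAddGroup X] [ContinuousSMul 𝕜 X] [T2Space X] [FiniteDimensional 𝕜 X]
    {ι : Type*} (e : X →ₗ[𝕜] (ι → 𝕜)) (he : Function.Injective e)
    {K : Type*} [TopologicalSpace K] {f : K → X} (hf : ∀ i, Continuous fun k => e (f k) i) : Continuous f := by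
  let E : X ≃ₗ[𝕜] ↥(LinearMap.range e) := LinearEquiv.ofInjective e he
  haveI : FiniteDimensional 𝕜 ↥(LinearMap.range e) := LinearEquiv.finiteDimensional E
  -- `E ∘ f` is continuous: a map into a subspace of `ι → 𝕜` is continuous iff its coordinates are
  have hg : Continuous fun k => E (f k) := by
    rw [continuous_induced_rng]
    have h : ((↑) ∘ fun k => E (f k) : K → (ι → 𝕜)) = fun k => e (f k) := funext fun k => LinearEquiv.ofInjective_apply e (h := he) (f k)
    rw [h]
    exact continuous_pi hf
  -- `E⁻¹` is continuous on the finite-dimensional range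
  have hf' : f = fun k => E.symm (E (f k)) := funext fun k => (E.symm_apply_apply (f k)).symm
  rw [hf']
  exact E.symm.toContinuousLinearEquiv.continuous.comp hg

variable {K : Type*} [Group K] [TopologicalSpace K]
  {X : Type*} [NormedAddCommGroup X] [InnerProductSpace ℂ X] [CompleteSpace X] [FiniteDimensional ℂ X]

/-- **(1b) A FINITE-DIMENSIONAL UNITARY REPRESENTATION IS A STRONGLY CONTINUOUS UNITARY `ContRepresentation`**: for an algebraic representation `ρ` of `K` on a finite-dimensional Hilbert
space `X` whose orbit maps `k ↦ ρ k x` are continuous and which preserves the inner product, `π k := LinearMap.toContinuousLinearMap (ρ k)` is a `ContRepresentation` with `π.toRepresentation = ρ`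
(so `π k x = ρ k x`), strongly continuous, unitary (★ `ContRepresentation.isUnitary_iff_inner_map_map`), and topologically irreducible if `ρ` is irreducible (★ `isTopIrreducible_of_isIrreducible`).
[cite: DeitmarEchterhoff2014, Lemma 6.1.7] [cite: Folland1995, §3.1] -/
theorem exists_contRepresentation_of_inner_map_map (ρ : Representation ℂ K X) (hc : ∀ x : X, Continuous fun k : K => ρ k x)
    (hu : ∀ (k : K) (x y : X), ⟪ρ k x, ρ k y⟫_ℂ = ⟪x, y⟫_ℂ) :
    ∃ π : ContRepresentation ℂ K X, π.toRepresentation = ρ ∧ (∀ (k : K) (x : X), π k x = ρ k x) ∧ π.IsStronglyContinuous ∧ π.IsUnitary ∧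
      (ρ.IsIrreducible → π.IsTopIrreducible) := by
  let π : ContRepresentation ℂ K X := ContRepresentation.ofMonoidHom
    { toFun := fun k => LinearMap.toContinuousLinearMap (ρ k)
      map_one' := by ext x; simp
      map_mul' := fun a b => by ext x; simp }
  have hπ : ∀ (k : K) (x : X), π k x = ρ k x := fun _ _ => rfl
  have hrep : π.toRepresentation = ρ := by
    refine MonoidHom.ext fun k => LinearMap.ext fun x => ?_
    rfl
  refine ⟨π, hrep, hπ, fun x => hc x, ContRepresentation.isUnitary_iff_inner_map_map.mpr hu, fun hirr => ?_⟩
  haveI : π.toRepresentation.IsIrreducible := by rw [hrep]; exact hirr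
  exact isTopIrreducible_of_isIrreducible π

/-- **(1c) PACKAGING THROUGH A UNITARY TRIVIALISATION** (K2E1-p12 (g6)'s interface card (4·i), bytes verbatim): for an IRREDUCIBLE representation `ρ` of `K` on any `ℂ`-space `V` and a linear
equivalence `e : V ≃ₗ[ℂ] E` onto a finite-dimensional Hilbert space `E` through which `ρ` preserves `⟪·,·⟫` (`⟪e (ρ k v), e (ρ k w)⟫ = ⟪e v, e w⟫`) and has continuous orbit maps (`k ↦ e (ρ k v)`),
the transported representation `k ↦ e ∘ ρ k ∘ e⁻¹` IS a `ContRepresentation` `π` of `K` on `E` with `π k (e v) = e (ρ k v)`, unitary, strongly continuous and topologically irreducible ((1b) at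
`ρE := e ∘ ρ ∘ e⁻¹`; irreducibility along `e` by ★ `Representation.isIrreducible_iff_of_equivariant`).  No topology on `V` is ever used — this is what keeps the consumer's `V := ↥W₀` (which
already carries the product-subspace topology of `G(𝔸) → ℂ`) free of instance diamonds. [cite: DeitmarEchterhoff2014, Lemma 6.1.7] [cite: Folland1995, §3.1] -/
theorem exists_contRepresentation_of_unitaryTrivialisation {K : Type*} [Group K] [TopologicalSpace K] {V : Type*} [AddCommGroup V] [Module ℂ V]
    (ρ : Representation ℂ K V) (hirr : ρ.IsIrreducible)
    {E : Type*} [NormedAddCommGroup E] [InnerProductSpace ℂ E] [CompleteSpace E] [FiniteDimensional ℂ E] (e : V ≃ₗ[ℂ] E)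
    (hu : ∀ (k : K) (v w : V), ⟪e (ρ k v), e (ρ k w)⟫_ℂ = ⟪e v, e w⟫_ℂ) (hc : ∀ v : V, Continuous fun k : K => e (ρ k v)) :
    ∃ π : ContRepresentation ℂ K E, (∀ (k : K) (v : V), π k (e v) = e (ρ k v)) ∧ π.IsUnitary ∧ π.IsStronglyContinuous ∧ π.IsTopIrreducible := by
  -- `ρ` conjugated by `e`
  let ρE : Representation ℂ K E :=
    { toFun := fun k => e.toLinearMap ∘ₗ ρ k ∘ₗ e.symm.toLinearMap
      map_one' := by ext x; simp
      map_mul' := fun a b => by ext x; simp }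
  have hρE : ∀ (k : K) (x : E), ρE k x = e (ρ k (e.symm x)) := fun _ _ => rfl
  have heρ : ∀ (k : K) (v : V), e (ρ k v) = ρE k (e v) := fun k v => by rw [hρE, LinearEquiv.symm_apply_apply]
  have hcE : ∀ x : E, Continuous fun k : K => ρE k x := fun x => by
    have h : (fun k : K => ρE k x) = fun k : K => e (ρ k (e.symm x)) := funext fun k => hρE k x
    rw [h]
    exact hc (e.symm x)
  have huE : ∀ (k : K) (x y : E), ⟪ρE k x, ρE k y⟫_ℂ = ⟪x, y⟫_ℂ := fun k x y => by
    rw [hρE, hρE, hu, LinearEquiv.apply_symm_apply, LinearEquiv.apply_symm_apply]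
  have hirrE : ρE.IsIrreducible := (Representation.isIrreducible_iff_of_equivariant ρ ρE (MonoidHom.id K) Function.surjective_id e heρ).1 hirr
  have hh := exists_contRepresentation_of_inner_map_map ρE hcE huE
  obtain ⟨π, -, hπ, hsc, hU, hti⟩ := hh
  exact ⟨π, fun k v => by rw [hπ, heρ], hU, hsc, hti hirrE⟩

end Generic

/-! ## §2 The CM `U(3)` block: the `K_max`-invariant Haar core, strong continuity on `ι(K_∞)`, and the package -/

section Block

variable (L : Type) [Field L] [NumberField L] [IsCMField L]

/-- **(2a) THE `K_max`-INVARIANT INNER-PRODUCT CORE ON A SPACE OF CONTINUOUS PAIR-SECTIONS** (★ β2 `exists_invariant_definite_form_kMax`'s recipe, re-run as an `InnerProductSpace.Core`): for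
ANY space `S` of continuous `(χ₁, χ₂)`-pair-sections of `G(𝔸) = U(J₃)(𝔸_{L⁺})`, `⟪a, b⟫ := ∫_{K_max} conj (a x⁻¹) · b x⁻¹ ∂haar` is Hermitian, has `re ⟪a, a⟫ = ∫ ‖a‖² ≥ 0`, is conjugate-linear
in `a`, and is DEFINITE (a continuous section with `∫_{K_max} ‖a‖² = 0` vanishes on `K_max` — Haar is positive on opens — hence everywhere by the pair law and ★ CM adelic Iwasawa
`G(𝔸) = B(𝔸)·K_max`); and it is INVARIANT under `r(k)`, `k ∈ K_max` (left-invariance of Haar on the compact group `K_max`, ★ `isCompact_comap_adelicVal_standardMaximalCompactGL`), stated with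
membership binders `r(k)a, r(k)b ∈ S` so that `ι(K_∞)`-stable and `K_max`-stable `S` are both served.  No finite-dimensionality is used. [cite: BrockerTomDieck1985, II (1.7)]
[cite: MoeglinWaldspurger1995, I.2.17] -/
theorem exists_core_kMax_invariant (χ₁ : HeckeCharacter L) (χ₂ : ↥(TorusDict.torus (IsCMField.complexConj L)) →ₜ* ℂˣ)
    (S : Submodule ℂ ((quasiSplit (↥(maximalRealSubfield L)) L (IsCMField.complexConj L) 3).Adelic → ℂ))
    (hSP : ∀ ψ ∈ S, IsChiSectionPair χ₁ χ₂ ψ) (hSc : ∀ ψ ∈ S, Continuous ψ) :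
    ∃ core : InnerProductSpace.Core ℂ ↥S,
      ∀ (k : ↥((standardMaximalCompactGL 3 L).comap (adelicVal (↥(maximalRealSubfield L)) L (IsCMField.complexConj L) 3 ((StdForm.antidiagonal 3).over L)) :
          Subgroup (quasiSplit (↥(maximalRealSubfield L)) L (IsCMField.complexConj L) 3).Adelic)) (a b : ↥S)
        (ha : rightTranslation (quasiSplit (↥(maximalRealSubfield L)) L (IsCMField.complexConj L) 3) (k : (quasiSplit (↥(maximalRealSubfield L)) L (IsCMField.complexConj L) 3).Adelic) (a : (quasiSplit (↥(maximalRealSubfield L)) L (IsCMField.complexConj L) 3).Adelic → ℂ) ∈ S)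
        (hb : rightTranslation (quasiSplit (↥(maximalRealSubfield L)) L (IsCMField.complexConj L) 3) (k : (quasiSplit (↥(maximalRealSubfield L)) L (IsCMField.complexConj L) 3).Adelic) (b : (quasiSplit (↥(maximalRealSubfield L)) L (IsCMField.complexConj L) 3).Adelic → ℂ) ∈ S),
        @inner ℂ ↥S core.toInner ⟨_, ha⟩ ⟨_, hb⟩ = @inner ℂ ↥S core.toInner a b := by
  -- the compact group `K_max` and its Haar measure (★ β2's preamble)
  haveI := t2Space_adeleRing_of_numberField L
  haveI : T2Space (quasiSplit (↥(maximalRealSubfield L)) L (IsCMField.complexConj L) 3).Adelic := inferInstanceAs (T2Space (adelic (↥(maximalRealSubfield L)) L (IsCMField.complexConj L) 3 ((StdForm.antidiagonal 3).over L)))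
  haveI : CompactSpace ↥((standardMaximalCompactGL 3 L).comap (adelicVal (↥(maximalRealSubfield L)) L (IsCMField.complexConj L) 3 ((StdForm.antidiagonal 3).over L)) :
      Subgroup (quasiSplit (↥(maximalRealSubfield L)) L (IsCMField.complexConj L) 3).Adelic) := isCompact_iff_compactSpace.1 isCompact_comap_adelicVal_standardMaximalCompactGL
  letI : MeasurableSpace ↥((standardMaximalCompactGL 3 L).comap (adelicVal (↥(maximalRealSubfield L)) L (IsCMField.complexConj L) 3 ((StdForm.antidiagonal 3).over L)) :
      Subgroup (quasiSplit (↥(maximalRealSubfield L)) L (IsCMField.complexConj L) 3).Adelic) := borel _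
  haveI : BorelSpace ↥((standardMaximalCompactGL 3 L).comap (adelicVal (↥(maximalRealSubfield L)) L (IsCMField.complexConj L) 3 ((StdForm.antidiagonal 3).over L)) :
      Subgroup (quasiSplit (↥(maximalRealSubfield L)) L (IsCMField.complexConj L) 3).Adelic) := ⟨rfl⟩
  -- the integrand `x ↦ conj (a x⁻¹) · b x⁻¹`, its continuity and integrability
  have hcont : ∀ a : ↥S, Continuous fun x : ↥((standardMaximalCompactGL 3 L).comap (adelicVal (↥(maximalRealSubfield L)) L (IsCMField.complexConj L) 3 ((StdForm.antidiagonal 3).over L)) :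
      Subgroup (quasiSplit (↥(maximalRealSubfield L)) L (IsCMField.complexConj L) 3).Adelic) => (a : (quasiSplit (↥(maximalRealSubfield L)) L (IsCMField.complexConj L) 3).Adelic → ℂ) ((x⁻¹ : ↥((standardMaximalCompactGL 3 L).comap (adelicVal (↥(maximalRealSubfield L)) L (IsCMField.complexConj L) 3 ((StdForm.antidiagonal 3).over L)) :
      Subgroup (quasiSplit (↥(maximalRealSubfield L)) L (IsCMField.complexConj L) 3).Adelic)) : (quasiSplit (↥(maximalRealSubfield L)) L (IsCMField.complexConj L) 3).Adelic) := fun a =>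
    (hSc a a.2).comp (continuous_subtype_val.comp continuous_inv)
  have hint : ∀ a b : ↥S, Integrable (fun x : ↥((standardMaximalCompactGL 3 L).comap (adelicVal (↥(maximalRealSubfield L)) L (IsCMField.complexConj L) 3 ((StdForm.antidiagonal 3).over L)) :
      Subgroup (quasiSplit (↥(maximalRealSubfield L)) L (IsCMField.complexConj L) 3).Adelic) => conj ((a : (quasiSplit (↥(maximalRealSubfield L)) L (IsCMField.complexConj L) 3).Adelic → ℂ) ((x⁻¹ : ↥((standardMaximalCompactGL 3 L).comap (adelicVal (↥(maximalRealSubfield L)) L (IsCMField.complexConj L) 3 ((StdForm.antidiagonal 3).over L)) :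
      Subgroup (quasiSplit (↥(maximalRealSubfield L)) L (IsCMField.complexConj L) 3).Adelic)) : (quasiSplit (↥(maximalRealSubfield L)) L (IsCMField.complexConj L) 3).Adelic)) * (b : (quasiSplit (↥(maximalRealSubfield L)) L (IsCMField.complexConj L) 3).Adelic → ℂ) ((x⁻¹ : ↥((standardMaximalCompactGL 3 L).comap (adelicVal (↥(maximalRealSubfield L)) L (IsCMField.complexConj L) 3 ((StdForm.antidiagonal 3).over L)) :
      Subgroup (quasiSplit (↥(maximalRealSubfield L)) L (IsCMField.complexConj L) 3).Adelic)) : (quasiSplit (↥(maximalRealSubfield L)) L (IsCMField.complexConj L) 3).Adelic)) Measure.haar := fun a b =>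
    MeasureTheory.integrableOn_univ.1 ((((Complex.continuous_conj.comp (hcont a)).mul (hcont b)).continuousOn).integrableOn_compact isCompact_univ)
  -- `∫ conj a · a = ∫ ‖a‖²` (as a real integral)
  have hsq : ∀ a : ↥S, (∫ x : ↥((standardMaximalCompactGL 3 L).comap (adelicVal (↥(maximalRealSubfield L)) L (IsCMField.complexConj L) 3 ((StdForm.antidiagonal 3).over L)) :
      Subgroup (quasiSplit (↥(maximalRealSubfield L)) L (IsCMField.complexConj L) 3).Adelic), conj ((a : (quasiSplit (↥(maximalRealSubfield L)) L (IsCMField.complexConj L) 3).Adelic → ℂ) ((x⁻¹ : ↥((standardMaximalCompactGL 3 L).comap (adelicVal (↥(maximalRealSubfield L)) L (IsCMField.complexConj L) 3 ((StdForm.antidiagonal 3).over L)) :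
      Subgroup (quasiSplit (↥(maximalRealSubfield L)) L (IsCMField.complexConj L) 3).Adelic)) : (quasiSplit (↥(maximalRealSubfield L)) L (IsCMField.complexConj L) 3).Adelic)) * (a : (quasiSplit (↥(maximalRealSubfield L)) L (IsCMField.complexConj L) 3).Adelic → ℂ) ((x⁻¹ : ↥((standardMaximalCompactGL 3 L).comap (adelicVal (↥(maximalRealSubfield L)) L (IsCMField.complexConj L) 3 ((StdForm.antidiagonal 3).over L)) :
      Subgroup (quasiSplit (↥(maximalRealSubfield L)) L (IsCMField.complexConj L) 3).Adelic)) : (quasiSplit (↥(maximalRealSubfield L)) L (IsCMField.complexConj L) 3).Adelic) ∂Measure.haar) =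
        ((∫ x : ↥((standardMaximalCompactGL 3 L).comap (adelicVal (↥(maximalRealSubfield L)) L (IsCMField.complexConj L) 3 ((StdForm.antidiagonal 3).over L)) :
      Subgroup (quasiSplit (↥(maximalRealSubfield L)) L (IsCMField.complexConj L) 3).Adelic), ‖(a : (quasiSplit (↥(maximalRealSubfield L)) L (IsCMField.complexConj L) 3).Adelic → ℂ) ((x⁻¹ : ↥((standardMaximalCompactGL 3 L).comap (adelicVal (↥(maximalRealSubfield L)) L (IsCMField.complexConj L) 3 ((StdForm.antidiagonal 3).over L)) :
      Subgroup (quasiSplit (↥(maximalRealSubfield L)) L (IsCMField.complexConj L) 3).Adelic)) : (quasiSplit (↥(maximalRealSubfield L)) L (IsCMField.complexConj L) 3).Adelic)‖ ^ 2 ∂Measure.haar : ℝ) : ℂ) := fun a => by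
    rw [← integral_complex_ofReal]
    exact integral_congr_ae (Eventually.of_forall fun x => by simp only [Complex.conj_mul', Complex.ofReal_pow])
  -- THE CORE
  let core : InnerProductSpace.Core ℂ ↥S :=
    { inner := fun a b => ∫ x : ↥((standardMaximalCompactGL 3 L).comap (adelicVal (↥(maximalRealSubfield L)) L (IsCMField.complexConj L) 3 ((StdForm.antidiagonal 3).over L)) :
      Subgroup (quasiSplit (↥(maximalRealSubfield L)) L (IsCMField.complexConj L) 3).Adelic), conj ((a : (quasiSplit (↥(maximalRealSubfield L)) L (IsCMField.complexConj L) 3).Adelic → ℂ) ((x⁻¹ : ↥((standardMaximalCompactGL 3 L).comap (adelicVal (↥(maximalRealSubfield L)) L (IsCMField.complexConj L) 3 ((StdForm.antidiagonal 3).over L)) :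
      Subgroup (quasiSplit (↥(maximalRealSubfield L)) L (IsCMField.complexConj L) 3).Adelic)) : (quasiSplit (↥(maximalRealSubfield L)) L (IsCMField.complexConj L) 3).Adelic)) * (b : (quasiSplit (↥(maximalRealSubfield L)) L (IsCMField.complexConj L) 3).Adelic → ℂ) ((x⁻¹ : ↥((standardMaximalCompactGL 3 L).comap (adelicVal (↥(maximalRealSubfield L)) L (IsCMField.complexConj L) 3 ((StdForm.antidiagonal 3).over L)) :
      Subgroup (quasiSplit (↥(maximalRealSubfield L)) L (IsCMField.complexConj L) 3).Adelic)) : (quasiSplit (↥(maximalRealSubfield L)) L (IsCMField.complexConj L) 3).Adelic) ∂Measure.haar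
      conj_inner_symm := fun a b => by
        show conj (∫ x, conj (((b : ↥S) : (quasiSplit (↥(maximalRealSubfield L)) L (IsCMField.complexConj L) 3).Adelic → ℂ) _) * ((a : ↥S) : (quasiSplit (↥(maximalRealSubfield L)) L (IsCMField.complexConj L) 3).Adelic → ℂ) _ ∂Measure.haar) =
          ∫ x, conj (((a : ↥S) : (quasiSplit (↥(maximalRealSubfield L)) L (IsCMField.complexConj L) 3).Adelic → ℂ) _) * ((b : ↥S) : (quasiSplit (↥(maximalRealSubfield L)) L (IsCMField.complexConj L) 3).Adelic → ℂ) _ ∂Measure.haar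
        rw [← integral_conj]
        exact integral_congr_ae (Eventually.of_forall fun x => by simp only [map_mul, Complex.conj_conj, mul_comm])
      re_inner_nonneg := fun a => by
        show 0 ≤ Complex.re (∫ x, conj (((a : ↥S) : (quasiSplit (↥(maximalRealSubfield L)) L (IsCMField.complexConj L) 3).Adelic → ℂ) _) * ((a : ↥S) : (quasiSplit (↥(maximalRealSubfield L)) L (IsCMField.complexConj L) 3).Adelic → ℂ) _ ∂Measure.haar)
        rw [hsq a, Complex.ofReal_re]
        exact integral_nonneg fun x => sq_nonneg _
      add_left := fun a a' b => by
        show (∫ x, conj ((((a + a' : ↥S)) : (quasiSplit (↥(maximalRealSubfield L)) L (IsCMField.complexConj L) 3).Adelic → ℂ) _) * ((b : ↥S) : (quasiSplit (↥(maximalRealSubfield L)) L (IsCMField.complexConj L) 3).Adelic → ℂ) _ ∂Measure.haar) =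
          (∫ x, conj (((a : ↥S) : (quasiSplit (↥(maximalRealSubfield L)) L (IsCMField.complexConj L) 3).Adelic → ℂ) _) * ((b : ↥S) : (quasiSplit (↥(maximalRealSubfield L)) L (IsCMField.complexConj L) 3).Adelic → ℂ) _ ∂Measure.haar) +
          ∫ x, conj (((a' : ↥S) : (quasiSplit (↥(maximalRealSubfield L)) L (IsCMField.complexConj L) 3).Adelic → ℂ) _) * ((b : ↥S) : (quasiSplit (↥(maximalRealSubfield L)) L (IsCMField.complexConj L) 3).Adelic → ℂ) _ ∂Measure.haar
        rw [← integral_add (hint a b) (hint a' b)]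
        exact integral_congr_ae (Eventually.of_forall fun x => by simp only [Submodule.coe_add, Pi.add_apply, map_add, add_mul])
      smul_left := fun a b c => by
        show (∫ x, conj ((((c • a : ↥S)) : (quasiSplit (↥(maximalRealSubfield L)) L (IsCMField.complexConj L) 3).Adelic → ℂ) _) * ((b : ↥S) : (quasiSplit (↥(maximalRealSubfield L)) L (IsCMField.complexConj L) 3).Adelic → ℂ) _ ∂Measure.haar) =
          conj c * ∫ x, conj (((a : ↥S) : (quasiSplit (↥(maximalRealSubfield L)) L (IsCMField.complexConj L) 3).Adelic → ℂ) _) * ((b : ↥S) : (quasiSplit (↥(maximalRealSubfield L)) L (IsCMField.complexConj L) 3).Adelic → ℂ) _ ∂Measure.haar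
        rw [← integral_const_mul]
        exact integral_congr_ae (Eventually.of_forall fun x => by simp only [Submodule.coe_smul, Pi.smul_apply, smul_eq_mul, map_mul, mul_assoc])
      definite := fun a ha => by
        change (∫ x, conj (((a : ↥S) : (quasiSplit (↥(maximalRealSubfield L)) L (IsCMField.complexConj L) 3).Adelic → ℂ) _) * ((a : ↥S) : (quasiSplit (↥(maximalRealSubfield L)) L (IsCMField.complexConj L) 3).Adelic → ℂ) _ ∂Measure.haar) = 0 at ha
        rw [hsq a, Complex.ofReal_eq_zero] at ha
        have hnn : 0 ≤ fun x : ↥((standardMaximalCompactGL 3 L).comap (adelicVal (↥(maximalRealSubfield L)) L (IsCMField.complexConj L) 3 ((StdForm.antidiagonal 3).over L)) :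
          Subgroup (quasiSplit (↥(maximalRealSubfield L)) L (IsCMField.complexConj L) 3).Adelic) => ‖(a : (quasiSplit (↥(maximalRealSubfield L)) L (IsCMField.complexConj L) 3).Adelic → ℂ) ((x⁻¹ : ↥((standardMaximalCompactGL 3 L).comap (adelicVal (↥(maximalRealSubfield L)) L (IsCMField.complexConj L) 3 ((StdForm.antidiagonal 3).over L)) :
          Subgroup (quasiSplit (↥(maximalRealSubfield L)) L (IsCMField.complexConj L) 3).Adelic)) : (quasiSplit (↥(maximalRealSubfield L)) L (IsCMField.complexConj L) 3).Adelic)‖ ^ 2 := fun x => sq_nonneg _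
        have hint2 : Integrable (fun x : ↥((standardMaximalCompactGL 3 L).comap (adelicVal (↥(maximalRealSubfield L)) L (IsCMField.complexConj L) 3 ((StdForm.antidiagonal 3).over L)) :
          Subgroup (quasiSplit (↥(maximalRealSubfield L)) L (IsCMField.complexConj L) 3).Adelic) => ‖(a : (quasiSplit (↥(maximalRealSubfield L)) L (IsCMField.complexConj L) 3).Adelic → ℂ) ((x⁻¹ : ↥((standardMaximalCompactGL 3 L).comap (adelicVal (↥(maximalRealSubfield L)) L (IsCMField.complexConj L) 3 ((StdForm.antidiagonal 3).over L)) :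
          Subgroup (quasiSplit (↥(maximalRealSubfield L)) L (IsCMField.complexConj L) 3).Adelic)) : (quasiSplit (↥(maximalRealSubfield L)) L (IsCMField.complexConj L) 3).Adelic)‖ ^ 2) Measure.haar :=
          MeasureTheory.integrableOn_univ.1 ((((hcont a).norm.pow 2).continuousOn).integrableOn_compact isCompact_univ)
        have hae := (integral_eq_zero_iff_of_nonneg hnn hint2).1 ha
        have hzero : (fun x : ↥((standardMaximalCompactGL 3 L).comap (adelicVal (↥(maximalRealSubfield L)) L (IsCMField.complexConj L) 3 ((StdForm.antidiagonal 3).over L)) :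
          Subgroup (quasiSplit (↥(maximalRealSubfield L)) L (IsCMField.complexConj L) 3).Adelic) => ‖(a : (quasiSplit (↥(maximalRealSubfield L)) L (IsCMField.complexConj L) 3).Adelic → ℂ) ((x⁻¹ : ↥((standardMaximalCompactGL 3 L).comap (adelicVal (↥(maximalRealSubfield L)) L (IsCMField.complexConj L) 3 ((StdForm.antidiagonal 3).over L)) :
          Subgroup (quasiSplit (↥(maximalRealSubfield L)) L (IsCMField.complexConj L) 3).Adelic)) : (quasiSplit (↥(maximalRealSubfield L)) L (IsCMField.complexConj L) 3).Adelic)‖ ^ 2) = fun _ => 0 :=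
          (Continuous.ae_eq_iff_eq Measure.haar ((hcont a).norm.pow 2) continuous_const).1 hae
        -- `a` vanishes on `K_max`, hence everywhere (pair law + CM Iwasawa)
        have hK : ∀ k : ↥((standardMaximalCompactGL 3 L).comap (adelicVal (↥(maximalRealSubfield L)) L (IsCMField.complexConj L) 3 ((StdForm.antidiagonal 3).over L)) :
          Subgroup (quasiSplit (↥(maximalRealSubfield L)) L (IsCMField.complexConj L) 3).Adelic), (a : (quasiSplit (↥(maximalRealSubfield L)) L (IsCMField.complexConj L) 3).Adelic → ℂ) (k : (quasiSplit (↥(maximalRealSubfield L)) L (IsCMField.complexConj L) 3).Adelic) = 0 := fun k => by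
          have h := congrFun hzero k⁻¹
          exact norm_eq_zero.1 ((pow_eq_zero_iff two_ne_zero).1 (by simpa only [inv_inv] using h))
        refine Subtype.ext (funext fun g => ?_)
        obtain ⟨b, hb, k, hk, rfl⟩ := exists_mem_borelAdelic_mul_mem_standardMaximalCompactGL_cm_three L g
        rw [hSP a a.2 b hb k, hK ⟨k, Subgroup.mem_comap.2 hk⟩, mul_zero]
        rfl }
  refine ⟨core, fun k a b ha hb => ?_⟩
  -- invariance: `(r(k)a)(x⁻¹) = a(x⁻¹ k) = a((k⁻¹x)⁻¹)`, and `x ↦ k⁻¹ x` preserves Haar on `K_max`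
  show (∫ x : ↥((standardMaximalCompactGL 3 L).comap (adelicVal (↥(maximalRealSubfield L)) L (IsCMField.complexConj L) 3 ((StdForm.antidiagonal 3).over L)) :
      Subgroup (quasiSplit (↥(maximalRealSubfield L)) L (IsCMField.complexConj L) 3).Adelic), conj ((rightTranslation (quasiSplit (↥(maximalRealSubfield L)) L (IsCMField.complexConj L) 3) (k : (quasiSplit (↥(maximalRealSubfield L)) L (IsCMField.complexConj L) 3).Adelic) (a : (quasiSplit (↥(maximalRealSubfield L)) L (IsCMField.complexConj L) 3).Adelic → ℂ)) ((x⁻¹ : ↥((standardMaximalCompactGL 3 L).comap (adelicVal (↥(maximalRealSubfield L)) L (IsCMField.complexConj L) 3 ((StdForm.antidiagonal 3).over L)) :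
      Subgroup (quasiSplit (↥(maximalRealSubfield L)) L (IsCMField.complexConj L) 3).Adelic)) : (quasiSplit (↥(maximalRealSubfield L)) L (IsCMField.complexConj L) 3).Adelic)) * (rightTranslation (quasiSplit (↥(maximalRealSubfield L)) L (IsCMField.complexConj L) 3) (k : (quasiSplit (↥(maximalRealSubfield L)) L (IsCMField.complexConj L) 3).Adelic) (b : (quasiSplit (↥(maximalRealSubfield L)) L (IsCMField.complexConj L) 3).Adelic → ℂ)) ((x⁻¹ : ↥((standardMaximalCompactGL 3 L).comap (adelicVal (↥(maximalRealSubfield L)) L (IsCMField.complexConj L) 3 ((StdForm.antidiagonal 3).over L)) :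
      Subgroup (quasiSplit (↥(maximalRealSubfield L)) L (IsCMField.complexConj L) 3).Adelic)) : (quasiSplit (↥(maximalRealSubfield L)) L (IsCMField.complexConj L) 3).Adelic) ∂Measure.haar) =
      ∫ x : ↥((standardMaximalCompactGL 3 L).comap (adelicVal (↥(maximalRealSubfield L)) L (IsCMField.complexConj L) 3 ((StdForm.antidiagonal 3).over L)) :
      Subgroup (quasiSplit (↥(maximalRealSubfield L)) L (IsCMField.complexConj L) 3).Adelic), conj ((a : (quasiSplit (↥(maximalRealSubfield L)) L (IsCMField.complexConj L) 3).Adelic → ℂ) ((x⁻¹ : ↥((standardMaximalCompactGL 3 L).comap (adelicVal (↥(maximalRealSubfield L)) L (IsCMField.complexConj L) 3 ((StdForm.antidiagonal 3).over L)) :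
      Subgroup (quasiSplit (↥(maximalRealSubfield L)) L (IsCMField.complexConj L) 3).Adelic)) : (quasiSplit (↥(maximalRealSubfield L)) L (IsCMField.complexConj L) 3).Adelic)) * (b : (quasiSplit (↥(maximalRealSubfield L)) L (IsCMField.complexConj L) 3).Adelic → ℂ) ((x⁻¹ : ↥((standardMaximalCompactGL 3 L).comap (adelicVal (↥(maximalRealSubfield L)) L (IsCMField.complexConj L) 3 ((StdForm.antidiagonal 3).over L)) :
      Subgroup (quasiSplit (↥(maximalRealSubfield L)) L (IsCMField.complexConj L) 3).Adelic)) : (quasiSplit (↥(maximalRealSubfield L)) L (IsCMField.complexConj L) 3).Adelic) ∂Measure.haar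
  have h := MeasureTheory.integral_mul_left_eq_self
    (fun x : ↥((standardMaximalCompactGL 3 L).comap (adelicVal (↥(maximalRealSubfield L)) L (IsCMField.complexConj L) 3 ((StdForm.antidiagonal 3).over L)) :
      Subgroup (quasiSplit (↥(maximalRealSubfield L)) L (IsCMField.complexConj L) 3).Adelic) => conj ((a : (quasiSplit (↥(maximalRealSubfield L)) L (IsCMField.complexConj L) 3).Adelic → ℂ) ((x⁻¹ : ↥((standardMaximalCompactGL 3 L).comap (adelicVal (↥(maximalRealSubfield L)) L (IsCMField.complexConj L) 3 ((StdForm.antidiagonal 3).over L)) :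
      Subgroup (quasiSplit (↥(maximalRealSubfield L)) L (IsCMField.complexConj L) 3).Adelic)) : (quasiSplit (↥(maximalRealSubfield L)) L (IsCMField.complexConj L) 3).Adelic)) * (b : (quasiSplit (↥(maximalRealSubfield L)) L (IsCMField.complexConj L) 3).Adelic → ℂ) ((x⁻¹ : ↥((standardMaximalCompactGL 3 L).comap (adelicVal (↥(maximalRealSubfield L)) L (IsCMField.complexConj L) 3 ((StdForm.antidiagonal 3).over L)) :
      Subgroup (quasiSplit (↥(maximalRealSubfield L)) L (IsCMField.complexConj L) 3).Adelic)) : (quasiSplit (↥(maximalRealSubfield L)) L (IsCMField.complexConj L) 3).Adelic)) k⁻¹ (μ := (Measure.haar : Measure ↥((standardMaximalCompactGL 3 L).comap (adelicVal (↥(maximalRealSubfield L)) L (IsCMField.complexConj L) 3 ((StdForm.antidiagonal 3).over L)) :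
      Subgroup (quasiSplit (↥(maximalRealSubfield L)) L (IsCMField.complexConj L) 3).Adelic)))
  refine Eq.trans (integral_congr_ae (Eventually.of_forall fun x => ?_)) h
  simp only [rightTranslation_apply, mul_inv_rev, inv_inv, Subgroup.coe_mul]

/-- **(2b) STRONG CONTINUITY OF `r|_{W₀}` ON `ι(K_∞)`, READ IN ANY FINITE-DIMENSIONAL MODEL**: for a finite-dimensional `ι(K_∞)`-stable space `W₀` of CONTINUOUS functions on `G(𝔸)`, a linear
equivalence `T : ↥W₀ ≃ₗ[ℂ] X` onto a finite-dimensional Hausdorff topological vector space and `w ∈ W₀`, the orbit map `k ↦ T (ρ₀ k w) = T (w(· k))` is continuous on `ι(K_∞) = archMaximalCompact L`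
(subtype topology) — by (1a) with the injective `e := W₀.subtype ∘ T⁻¹ : X →ₗ (G(𝔸) → ℂ)`: the coordinates are the point evaluations `k ↦ w (x k)`, continuous because `w` and the multiplication
of `G(𝔸)` are. [cite: Folland1995, §3.1] [cite: BorelJacquet1979, §4.1] -/
theorem continuous_kInf_orbit_comp (W₀ : Submodule ℂ ((quasiSplit (↥(maximalRealSubfield L)) L (IsCMField.complexConj L) 3).Adelic → ℂ))
    (hW₀K : ∀ k : ↥(archMaximalCompact L), ∀ ψ ∈ W₀, ((rightTranslation (quasiSplit (↥(maximalRealSubfield L)) L (IsCMField.complexConj L) 3)).comp (archMaximalCompact L).subtype) k ψ ∈ W₀)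
    (hW₀c : ∀ ψ ∈ W₀, Continuous ψ)
    {X : Type*} [AddCommGroup X] [Module ℂ X] [TopologicalSpace X] [IsTopologicalAddGroup X] [ContinuousSMul ℂ X] [T2Space X] [FiniteDimensional ℂ X]
    (T : ↥W₀ ≃ₗ[ℂ] X) (w : ↥W₀) :
    Continuous fun k : ↥(archMaximalCompact L) =>
      T ((Subrepresentation.toRepresentation (⟨W₀, hW₀K⟩ : Subrepresentation ((rightTranslation (quasiSplit (↥(maximalRealSubfield L)) L (IsCMField.complexConj L) 3)).comp (archMaximalCompact L).subtype))) k w) := by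
  refine continuous_of_injective_of_continuous_apply (𝕜 := ℂ) (W₀.subtype ∘ₗ T.symm.toLinearMap) (Subtype.val_injective.comp T.symm.injective) fun x => ?_
  have h : (fun k : ↥(archMaximalCompact L) => (W₀.subtype ∘ₗ T.symm.toLinearMap)
      (T ((Subrepresentation.toRepresentation (⟨W₀, hW₀K⟩ : Subrepresentation ((rightTranslation (quasiSplit (↥(maximalRealSubfield L)) L (IsCMField.complexConj L) 3)).comp (archMaximalCompact L).subtype))) k w)) x) =
      fun k : ↥(archMaximalCompact L) => (w : (quasiSplit (↥(maximalRealSubfield L)) L (IsCMField.complexConj L) 3).Adelic → ℂ) (x * (k : (quasiSplit (↥(maximalRealSubfield L)) L (IsCMField.complexConj L) 3).Adelic)) := by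
    funext k
    rw [LinearMap.comp_apply, LinearEquiv.coe_toLinearMap, LinearEquiv.symm_apply_apply]
    rfl
  rw [h]
  exact (hW₀c w w.2).comp (continuous_const.mul continuous_subtype_val)

/-- **(2c) THE UNITARY TRIVIALISATION OF A FINITE-DIMENSIONAL `ι(K_∞)`-STABLE BLOCK OF CONTINUOUS PAIR-SECTIONS** (K2E1-p12 (g6)'s interface card (4·ii), `e`-form; (2a) + (2b)): for
`W₀ ≤ (G(𝔸) → ℂ)` finite-dimensional, `ι(K_∞)`-stable (`hW₀K`, the binder of `hCO′`), made of continuous `(χ₁, χ₂)`-pair-sections, the orthonormal-coordinate map of the `K_max`-invariant Haar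
inner product of (2a), `e : ↥W₀ ≃ₗ[ℂ] EuclideanSpace ℂ (Fin (finrank ℂ ↥W₀))` (Mathlib `stdOrthonormalBasis`, an isometry for that inner product — the structure lives on `↥W₀` INSIDE the proof only),
makes `ρ₀ := r|_{W₀}` unitary in the model (`⟪e (ρ₀ k v), e (ρ₀ k w)⟫ = ⟪e v, e w⟫`, `ι(K_∞) ≤ K_max` ★ `archMaximalCompact_le_kMax`) with continuous orbit maps `k ↦ e (ρ₀ k v)` ((2b)).  No
measure, no instance binder, no topology on `↥W₀` in the statement. [cite: BrockerTomDieck1985, II (1.7)] [cite: Folland1995, §3.1] -/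
theorem exists_unitaryTrivialisation_archMaximalCompact (χ₁ : HeckeCharacter L) (χ₂ : ↥(TorusDict.torus (IsCMField.complexConj L)) →ₜ* ℂˣ)
    (W₀ : Submodule ℂ ((quasiSplit (↥(maximalRealSubfield L)) L (IsCMField.complexConj L) 3).Adelic → ℂ))
    (hW₀K : ∀ k : ↥(archMaximalCompact L), ∀ ψ ∈ W₀, ((rightTranslation (quasiSplit (↥(maximalRealSubfield L)) L (IsCMField.complexConj L) 3)).comp (archMaximalCompact L).subtype) k ψ ∈ W₀)
    [FiniteDimensional ℂ ↥W₀] (hW₀P : ∀ ψ ∈ W₀, IsChiSectionPair χ₁ χ₂ ψ) (hW₀c : ∀ ψ ∈ W₀, Continuous ψ) :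
    ∃ e : ↥W₀ ≃ₗ[ℂ] EuclideanSpace ℂ (Fin (Module.finrank ℂ ↥W₀)),
      (∀ (k : ↥(archMaximalCompact L)) (v w : ↥W₀), ⟪e ((Subrepresentation.toRepresentation (⟨W₀, hW₀K⟩ : Subrepresentation ((rightTranslation (quasiSplit (↥(maximalRealSubfield L)) L (IsCMField.complexConj L) 3)).comp (archMaximalCompact L).subtype))) k v), e ((Subrepresentation.toRepresentation (⟨W₀, hW₀K⟩ : Subrepresentation ((rightTranslation (quasiSplit (↥(maximalRealSubfield L)) L (IsCMField.complexConj L) 3)).comp (archMaximalCompact L).subtype))) k w)⟫_ℂ = ⟪e v, e w⟫_ℂ) ∧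
      (∀ v : ↥W₀, Continuous fun k : ↥(archMaximalCompact L) => e ((Subrepresentation.toRepresentation (⟨W₀, hW₀K⟩ : Subrepresentation ((rightTranslation (quasiSplit (↥(maximalRealSubfield L)) L (IsCMField.complexConj L) 3)).comp (archMaximalCompact L).subtype))) k v)) := by
  -- (2a) the `K_max`-invariant core on `↥W₀`; `ρ₀` preserves it (`ι(K_∞) ≤ K_max`, stability `hW₀K`)
  obtain ⟨core, hinv⟩ := exists_core_kMax_invariant L χ₁ χ₂ W₀ hW₀P hW₀c
  have hu : ∀ (k : ↥(archMaximalCompact L)) (a b : ↥W₀),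
      @inner ℂ ↥W₀ core.toInner ((Subrepresentation.toRepresentation (⟨W₀, hW₀K⟩ : Subrepresentation ((rightTranslation (quasiSplit (↥(maximalRealSubfield L)) L (IsCMField.complexConj L) 3)).comp (archMaximalCompact L).subtype))) k a) ((Subrepresentation.toRepresentation (⟨W₀, hW₀K⟩ : Subrepresentation ((rightTranslation (quasiSplit (↥(maximalRealSubfield L)) L (IsCMField.complexConj L) 3)).comp (archMaximalCompact L).subtype))) k b) = @inner ℂ ↥W₀ core.toInner a b := fun k a b =>
    hinv ⟨(k : (quasiSplit (↥(maximalRealSubfield L)) L (IsCMField.complexConj L) 3).Adelic), archMaximalCompact_le_kMax L k.2⟩ a b (hW₀K k a a.2) (hW₀K k b b.2)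
  -- the inner-product structure on `↥W₀`, LOCALLY, and its orthonormal coordinates
  letI : NormedAddCommGroup ↥W₀ := @InnerProductSpace.Core.toNormedAddCommGroup ℂ ↥W₀ _ _ _ core
  letI : InnerProductSpace ℂ ↥W₀ := InnerProductSpace.ofCore core.toCore
  let b : OrthonormalBasis (Fin (Module.finrank ℂ ↥W₀)) ℂ ↥W₀ := stdOrthonormalBasis ℂ ↥W₀
  refine ⟨b.repr.toLinearEquiv, fun k v w => ?_, fun v => continuous_kInf_orbit_comp L W₀ hW₀K hW₀c b.repr.toLinearEquiv v⟩
  show ⟪b.repr ((Subrepresentation.toRepresentation (⟨W₀, hW₀K⟩ : Subrepresentation ((rightTranslation (quasiSplit (↥(maximalRealSubfield L)) L (IsCMField.complexConj L) 3)).comp (archMaximalCompact L).subtype))) k v), b.repr ((Subrepresentation.toRepresentation (⟨W₀, hW₀K⟩ : Subrepresentation ((rightTranslation (quasiSplit (↥(maximalRealSubfield L)) L (IsCMField.complexConj L) 3)).comp (archMaximalCompact L).subtype))) k w)⟫_ℂ = ⟪b.repr v, b.repr w⟫_ℂ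
  rw [b.repr.inner_map_map, b.repr.inner_map_map]
  exact hu k v w

/-- **(2d) HEAD — THE HILBERT PACKAGING OF AN IRREDUCIBLE FINITE-DIMENSIONAL `ι(K_∞)`-STABLE BLOCK OF CONTINUOUS PAIR-SECTIONS** ((2c) + (1c)): for `W₀ ≤ (G(𝔸) → ℂ)` finite-dimensional,
`ι(K_∞)`-stable, made of continuous `(χ₁, χ₂)`-pair-sections, with `ρ₀ := r|_{W₀}` irreducible (the binders of `hCO′`), there are a linear equivalence `e : ↥W₀ ≃ₗ[ℂ] EuclideanSpace ℂ (Fin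
(finrank ℂ ↥W₀))` and a representation `π : ContRepresentation ℂ ↥(archMaximalCompact L) (EuclideanSpace ℂ (Fin (finrank ℂ ↥W₀)))` on that HILBERT space with `π k (e w) = e (ρ₀ k w)`, unitary,
strongly continuous and topologically irreducible: EXACTLY the `(X, π, hπ, hU, hirr)` of ★ (α) `exists_forall_homSpace_torus_eq_smul_of_transpose_realisation` at `X := EuclideanSpace ℂ (Fin
(finrank ℂ ↥W₀))`, `Kv := ↥(archMaximalCompact L)` (subtype topology of `G(𝔸)`); `Hom`-lines and co-weight functionals for `π` pull back to `ρ₀` through `e` (★ `coweightLine_of_linearEquiv`).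
[cite: BrockerTomDieck1985, II (1.7)] [cite: DeitmarEchterhoff2014, Lemma 6.1.7] [cite: Folland1995, §3.1] -/
theorem exists_hilbertPackaging_kInf_block (χ₁ : HeckeCharacter L) (χ₂ : ↥(TorusDict.torus (IsCMField.complexConj L)) →ₜ* ℂˣ)
    (W₀ : Submodule ℂ ((quasiSplit (↥(maximalRealSubfield L)) L (IsCMField.complexConj L) 3).Adelic → ℂ))
    (hW₀K : ∀ k : ↥(archMaximalCompact L), ∀ ψ ∈ W₀, ((rightTranslation (quasiSplit (↥(maximalRealSubfield L)) L (IsCMField.complexConj L) 3)).comp (archMaximalCompact L).subtype) k ψ ∈ W₀)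
    [FiniteDimensional ℂ ↥W₀] (hW₀P : ∀ ψ ∈ W₀, IsChiSectionPair χ₁ χ₂ ψ) (hW₀c : ∀ ψ ∈ W₀, Continuous ψ)
    (hirr : (Subrepresentation.toRepresentation (⟨W₀, hW₀K⟩ : Subrepresentation ((rightTranslation (quasiSplit (↥(maximalRealSubfield L)) L (IsCMField.complexConj L) 3)).comp (archMaximalCompact L).subtype))).IsIrreducible) :
    ∃ (e : ↥W₀ ≃ₗ[ℂ] EuclideanSpace ℂ (Fin (Module.finrank ℂ ↥W₀))) (π : ContRepresentation ℂ ↥(archMaximalCompact L) (EuclideanSpace ℂ (Fin (Module.finrank ℂ ↥W₀)))),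
      (∀ (k : ↥(archMaximalCompact L)) (w : ↥W₀), π k (e w) = e ((Subrepresentation.toRepresentation (⟨W₀, hW₀K⟩ : Subrepresentation ((rightTranslation (quasiSplit (↥(maximalRealSubfield L)) L (IsCMField.complexConj L) 3)).comp (archMaximalCompact L).subtype))) k w)) ∧
      π.IsUnitary ∧ π.IsStronglyContinuous ∧ π.IsTopIrreducible := by
  have hT := exists_unitaryTrivialisation_archMaximalCompact L χ₁ χ₂ W₀ hW₀K hW₀P hW₀c
  obtain ⟨e, hu, hc⟩ := hT
  have hh := exists_contRepresentation_of_unitaryTrivialisation _ hirr e hu hc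
  obtain ⟨π, hπ, hU, hsc, hti⟩ := hh
  exact ⟨e, π, hπ, hU, hsc, hti⟩

end Block

end Summit.HodgeConjecture.HodgeConjecture.R90.S8

end
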